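import Mathlib
import HarnessLib
import HarnessLib.Audit
import Summits.AtomisticToContinuum.Statement
import Literature.MathematicalPhysics.QuantumManyBody.PeriodicBoseGas
import Literature.MathematicalPhysics.QuantumManyBody.PeriodicBoseGasFourier
import HarnessLib.Audit.Status.Attr

/-!
Route: BECTwoSectorGD

DORMANT since 2026-08-25T02:40:42Z (reconciler: no traction for 7.3 d (last activity item-evidence-added at 2026-08-17T18:55:01Z); parked, not closed — `ledger route dormant route-AtomisticToContinuum-BECTwoSectorGD --off` to reactivate) — unstaffed, not closed; items shared with open routes are served there. `ledger route dormant <id> --off` reactivates.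

# Route BECTwoSectorGD — two-sector Gaussian domination as a variational hypothesis, then
Kennedy–Lieb–Shastry verbatim to the conjunct

X_GD (TWO-SECTOR GAUSSIAN DOMINATION; card continuum-gaussian-domination — conforming gen-2
successor of the retired route
BECGaussianDomination, whose only defect was an Assembly ending in the Literature constant instead
of the sub-problem decl). It suffices
to show, for every repulsive finite-range INTEGRABLE radial v: (GaussianDomination) there are K, ρ₀,
C > 0 such that for all large N, every
torus of side L with (N+1)/L³ ≤ ρ₀ and every plane wave φ_n = L^(-3/2)e^(2πi n·x/L), 0 < |2πn/L| ≤
K, the block operator on H_N ⊕ H_(N+1)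
(H_N − E₀(N)) ⊕ (H_(N+1) − E₀(N+1)) + t·(a(φ_n) + a(φ_n)†), a(φ_n) : H_(N+1) → H_N the annihilation
of one particle in φ_n, is ≥ −C t² L²/‖n‖²
for |t| ≤ t₀(N,L,n) — equivalently (Kato, degenerate 2×2 second order; first order vanishes by
momentum conservation) the two T = 0
one-particle-transfer susceptibilities b₊(N,k), b₋(N+1,k) are ≤ C/k² (Gaussian domination UP TO A
CONSTANT; Bogoliubov value
b₊+b₋ = (k²+8πρa)/(k²(k²+16πρa)) ≤ 1/k²; the sharp constant is NOT claimed — false at one loop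
wherever v̂(k) < 0, card audits 2/14/29);
together with the two items the line does not own: BoundaryTransferWeak (shared
stmt-AtomisticToContinuum-0827) and the scope item
HardCoreExtension (integrable class ⇒ whole class). Downstream of GD everything is support:
KLSTransfer (GD ⇒ periodic infrared bound
n_k ≤ C(1 + √ρL/‖n‖ + ρL²/‖n‖²)) and ModeCounting (IR ⇒ constant-mode occupation ≥ cN on the torus,
Parseval + kinetic Chebyshev).
Lean: `∀ v : ℝ → ENNReal,
Literature.MathematicalPhysics.QuantumManyBody.BoseGas.IsRepulsiveFiniteRange v → (∫⁻ x :
EuclideanSpace ℝ (Fin 3), v ‖x‖) ≠ ⊤ → ∃ K : ℝ, 0 < K ∧ ∃ ρ₀ : ℝ, 0 < ρ₀ ∧ ∃ C : ℝ, 0 < C ∧ ∀ᶠ N : ℕ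
in Filter.atTop, ∀ L : ℝ, 0 < L → ((N : ℝ) + 1) ≤ ρ₀ * L ^ 3 → ∀ n : Fin 3 → ℤ, n ≠ 0 → 2 * Real.pi
/ L * ‖(fun j => (n j : ℝ))‖ ≤ K → ∃ t₀ : ℝ, 0 < t₀ ∧ ∀ t : ℝ, |t| ≤ t₀ → ∀ p : ℝ, 0 ≤ p → p ≤ 1 → ∀
Ψ : Literature.MathematicalPhysics.QuantumManyBody.BoseGas.PeriodicTrialState N L, ∀ Φ :
Literature.MathematicalPhysics.QuantumManyBody.BoseGas.PeriodicTrialState (N + 1) L,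
Literature.MathematicalPhysics.QuantumManyBody.BoseGas.periodicEnergy v Ψ ≠ ⊤ →
Literature.MathematicalPhysics.QuantumManyBody.BoseGas.periodicEnergy v Φ ≠ ⊤ → p *
(Literature.MathematicalPhysics.QuantumManyBody.BoseGas.periodicGroundStateEnergy v N L).toReal + (1
- p) * (Literature.MathematicalPhysics.QuantumManyBody.BoseGas.periodicGroundStateEnergy v (N + 1)
L).toReal - C * t ^ 2 * L ^ 2 / ‖(fun j => (n j : ℝ))‖ ^ 2 ≤ p *
(Literature.MathematicalPhysics.QuantumManyBody.BoseGas.periodicEnergy v Ψ).toReal + (1 - p) *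
(Literature.MathematicalPhysics.QuantumManyBody.BoseGas.periodicEnergy v Φ).toReal + 2 * t *
Real.sqrt (p * (1 - p)) * Real.sqrt ((N : ℝ) + 1) * (∫ Y in
Literature.MathematicalPhysics.QuantumManyBody.BoseGas.cellN N L, (starRingEnd ℂ) (Ψ.ψ Y) * ∫ x in
Literature.MathematicalPhysics.QuantumManyBody.BoseGas.cell L, (starRingEnd ℂ) (((Real.sqrt (L ^
3))⁻¹ : ℂ) * Literature.MathematicalPhysics.QuantumManyBody.BoseGas.cellWave L n x) * Φ.ψ
(Matrix.vecCons x Y)).re`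

## Assembly
Pure logic (term proof checked sorry-free in Sketch.lean and certified as glue.lean: `closes h_GD
h_T h_C h_B h_H := h_H (fun v hv hi =>
h_B v hv (h_C v hv hi (h_T v hv hi (h_GD v hv hi))))`, axioms propext / Classical.choice /
Quot.sound): for integrable v, GD feeds
KLSTransfer, whose infrared body feeds ModeCounting, whose PeriodicBEC body is exactly the
hypothesis of BoundaryTransferWeak; this gives
∃ρ₀ ∀ρ∈(0,ρ₀) HasGroundStateBEC v ρ on the integrable class, and HardCoreExtension extends to the
whole class — the sub-problem decl
`_root_.BoseEinsteinCondensation` by name. PeriodicInfraredBound is GD + KLSTransfer stand-alone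
(not a hypothesis of `closes`).

Rationale: WHY THIS LINE. Reflection positivity has only ever been used to obtain ONE inequality, Gaussian
domination E₀(H(h)) ≥ E₀(H) (DLS1978; KLS1988JSP eq. (18));
everything after it — susceptibility bound, spectral Cauchy–Schwarz against the double commutator,
sum rule, mode counting in d ≥ 3 — "depends
on no special properties of the Hamiltonian" (DLS1978 §1) and is PROVED in tree on the lattice
(namespace Literature.MathematicalPhysics.QuantumLattice:
kls_xy_gaussianDomination_ground_holds, kennedy_lieb_shastry_xy_ground_of_gaussianDomination,
kennedy_lieb_shastry_xy_ground_holds). This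
route files the continuum T = 0 GD itself as the crux, in the weakest typable form the transfer
needs (two ADJACENT canonical sectors each
measured from its own ground energy — no chemical potential, no convexity in N; constant C not 1;
window |k| ≤ K; densities ≤ ρ₀;
integrable v), with the dictionary S⁻_x ↦ a(φ_k): H_(N+1) → H_N, E_p ↦ k², e₁ − e₃cos p ↦
⟨[a_k,[H,a_k†]]⟩ ≤ k² + 2ρ‖v‖₁, sum rule ↦
Parseval on [0,L)³ (tsum_sq_cellFourierCoeff, tsum_sq_grad_cellFourierCoeff, proved), d ≥ 3 ↦ the
o(N) mode count of the window
k_c = ρ^(5/12). Why two sectors and not a number-conserving source: with a(φ_k) between adjacent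
sectors the KLS inequality bounds
2n_k + 1 = ‖a_kΩ‖² + ‖a_k†Ω‖² VERBATIM, whereas a conserving X_k = N^(-1/2)a_k†a₀ only bounds
⟨n̂₀n̂_k⟩/N (route BECThomsonPrinciple pays
for this with the LNSS operator a_k†a₀n̂₀^(-1/2)); the two GD statements are different items and can
die separately. Imported areas:
RP/infrared-bound statistical mechanics (DLS1978, FrohlichSimonSpencer1976, KLS1988PRL), Kato
perturbation theory (Kato1966), torus
Fourier analysis; physical heuristic for GD (card): a classical transfer wave pays Born ρv̂(0) per
particle and gains only μ = 8πρa < ρv̂(0).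
Negatives index: nothing near (only BECSwapAffinitySwapJensen in this sub).

RANKED CRUXES. #2 GaussianDomination (crux) — TWO-SECTOR GAUSSIAN DOMINATION (non-sharp, windowed,
integrable v; card item GD_can restated per audits 14/29/37): ∀ v repulsive finite-range with
∫v(|x|)dx < ∞ ∃ K ρ₀ C > 0 ∀ᶠ N ∀ L > 0 with (N+1) ≤ ρ₀L³ ∀ n ∈ ℤ³∖0 with |2πn/L| ≤ K ∃ t₀ > 0 ∀ |t|
≤ t₀ ∀ p ∈ [0,1] ∀ finite-energy periodic trial states Ψ (N particles), Φ (N+1 particles): p(E(Ψ) −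
E₀(N)) + (1−p)(E(Φ) − E₀(N+1)) + 2t√(p(1−p))·√(N+1)·Re∫conj(Ψ(Y))∫conj(φ_n(x))Φ(x,Y)dx dY ≥ −C t²
L²/‖n‖², φ_n = L^(-3/2)·cellWave L n — the variational form of inf spec[(H_N−E₀(N)) ⊕
(H_(N+1)−E₀(N+1)) + t(a(φ_n)+a(φ_n)†)] ≥ −Ct²L²/‖n‖², i.e. b₊(N,k), b₋(N+1,k) ≤ C′/k². [difficulty:
open-problem] (why it might fail: No RP in the continuum: beyond one loop nothing known keeps sup_N
k²b_k bounded at fixed small ρ (Gavoret–Nozières logs could enter b at k ~ 2π/L); Speer1985: GD can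
fail without RP; L-uniformity down to zero density at fixed N ≥ N₀ is also asserted.) [KLS1988JSP,
DLS1978, Speer1985, CorginiSankovich1999, LSSY2005, GavoretNozieres1964, BjornbergUeltschi2022]
#3 BoundaryTransferWeak (crux) — shared item stmt-AtomisticToContinuum-0827 VERBATIM (mode-free
boundary-condition transfer, per potential): for each repulsive finite-range v, PeriodicBEC(v) — ∃ρ₀
∀ρ<ρ₀ ∃c ∀ᶠN ∃δ: every δ-near-minimiser of the periodic energy at L=(N/ρ)^(1/3) has constant-mode
occupation ≥ cN — implies ∃ρ₀ ∀ρ∈(0,ρ₀) HasGroundStateBEC v ρ (Dirichlet, λ_max via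
condensateNumber). [difficulty: L] (why it might fail: PeriodicBEC(v) is ground-state-only (δ after
N): the Dirichlet GS is not a periodic near-minimiser (wall term ≫ δ above E₀^per), so no energy
comparison; needs a structural Neumann-bracketing + mode-free criterion (λ_max ≥ tr γ²/N) not in
print.) [LSSY2005, Robinson1976, arXiv:2603.20776, Fournais2020]
#4 HardCoreExtension (crux) — SCOPE ITEM (the part of the class this line does not reach): dilute
ground-state BEC for every repulsive finite-range INTEGRABLE radial v (∫v(|x|)dx < ∞) implies the
conjunct (all repulsive finite-range radial v, incl. hard cores v = ⊤·1_[0,a] and non-integrable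
singularities). The undressed transfer operator a(φ_k)† adds a plane-wave particle whose Hartree
energy ρ∫v is the double commutator's constant, so hard cores are out of reach of THIS engine;
expected discharges: route BECHardSphereReduction (HardCoreDominates + HardSphereBEC prove the whole
conjunct and moot this item), a-only technology (FournaisSolovej2022, LSSY2005 Lemma 2.5 Dyson
softening) or a Jastrow-dressed a(fφ_k); uniform-in-M truncation min(v,M)↑v is NOT available here
(constants carry ‖v‖₁). [difficulty: open-problem] (why it might fail: It is the conjunct on the
non-integrable class given the integrable one: no truncation/comparison principle transfers
condensate bounds from min(v,M) to v uniformly in M, condensate fractions are not monotone in v, and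
this line's constants blow up with ‖v‖₁.) [FournaisSolovej2022, LSSY2005, Fournais2020]
#9 KLSTransfer (support) — KENNEDY–LIEB–SHASTRY T=0 TRANSFER in the continuum: for integrable v, the
GaussianDomination body implies the periodic infrared-bound body — ∃K,ρ₀,C ∀ρ<ρ₀ ∀ᶠN ∃δ>0: every
δ-near-minimiser Ψ of the periodic N-body energy at L=(N/ρ)^(1/3) has n_Ψ(2πn/L) ≤ C(1 + √ρ·L/‖n‖ +
ρL²/‖n‖²) for 0<|2πn/L|≤K. On paper (KLS1988JSP (12)–(14); DLS1978 §1): (i) variational GD ⇒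
form-bounded block operator ⇒ (Kato, 2×2 degenerate second order, first order = 0 by momentum)
b₊(N), b₋(N) ≤ CL²/‖n‖² from the pairs (N,N+1), (N−1,N) at the same L; (ii) for the exact ground
state Ω: 2n_k+1 = ‖a_kΩ‖²+‖a_k†Ω‖² ≤ √((b₋+b₊)(d₋+d₊)) (Cauchy–Schwarz in the spectral measures of
H_(N∓1)−E₀(N∓1) ≥ 0), d₋+d₊ = ⟨[a_k,[H,a_k†]]⟩_Ω + μ⁻n_k − μ⁺(n_k+1) ≤ k² + 2ρ‖v‖₁ + ρ‖v‖₁n_k (|v̂|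
≤ ‖v‖₁; E₀(N+1) ≥ E₀(N); μ⁻ ≤ ρ‖v‖₁ by the product trial state), solve the quadratic inequality;
(iii) pass to δ-near-minimisers by compactness + uniqueness of Ω at fixed N, L (δ after N; finitely
many n; constant 2C). [difficulty: XL] [KLS1988JSP, DLS1978, Kato1966, ReedSimonIV1978]
#9 ModeCounting (support) — MODE COUNTING WITH THE √(ρa³) MODE DEFICIT: for integrable v, the
periodic infrared-bound body implies the PeriodicBEC body (hypothesis of BoundaryTransferWeak) —
constant-mode occupation ≥ cN. On paper: Parseval on [0,L)³ for x ↦ Ψ(x,Y)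
(tsum_sq_cellFourierCoeff) gives Σ_n n_Ψ(n) = N and Σ_n |2πn/L|² n_Ψ(n) = T(Ψ) ≤ E₀^per + δ ≤
½ρ‖v‖₁N + δ (constant trial state); window cutoff k_c = ρ^(5/12) ≤ K: Σ_(0<|k|≤k_c)
C(1+√ρL/‖n‖+ρL²/‖n‖²) ≲ (ρ^(1/4)+ρ^(1/3)+ρ^(5/12))N and Σ_(|k|>k_c) n_k ≤ T/k_c² ≤ (½‖v‖₁ρ^(1/6))N +
δρ^(-5/6) — all o(N); pick ρ₀ so n₀ ≥ N/2. [difficulty: L] [KLS1988PRL, DLS1978, LSSY2005,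
Fournais2020]
#9 PeriodicInfraredBound (support) — STAND-ALONE PERIODIC T=0 INFRARED BOUND (= GaussianDomination +
KLSTransfer by one line of logic, theorem ir_of_gd of the sketch; the torus twin of
BECInfraredBound.BecIrBoundInner with the cruder KLS shape): ∀ integrable repulsive finite-range v
∃K,ρ₀,C ∀ρ<ρ₀ ∀ᶠN ∃δ: every δ-near-minimiser Ψ of the periodic energy (L=(N/ρ)^(1/3)) has n_Ψ(2πn/L)
≤ C(1 + √ρL/‖n‖ + ρL²/‖n‖²) for 0<|2πn/L|≤K. Filed so refuters can attack the IR bound itself (¬ it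
kills the line) and so non-GD engines (sector-gap, SOS, Landau cards) can target it by signature.
Bogoliubov truth: n_k ≈ √(πρa)/|k| ∧ (ρa)²/|k|⁴. [difficulty: open-problem] [KLS1988PRL,
PitaevskiiStringari1991, LSSY2005]

TWO-LAYER PLAN. After GD closes or is split by an engine: KLSTransfer ⇐ OperatorGD (variational GD ⇒
susceptibility bound) → GroundStateKLS (IR for the
exact ground state) → KLSTransfer (near-minimisers); ModeCounting ⇐ TorusParseval (occupation and
kinetic sum rules for N-body states from
the proved one-body Parseval) → WindowSums (lattice-point sums Σ_(0<‖n‖≤m)(1, 1/‖n‖, 1/‖n‖²) ≤ C(m³,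
m², m)) → ModeCounting; k ≤ 3, depth 1.
GD itself may be split by an engine route (Thomson flows / SOS / log-concavity cards attach to the
decl by signature), never here before one closes.

KILL CRITERIA. ¬GaussianDomination for one admissible integrable v at arbitrarily small ρ (e.g.
k²b_k → ∞ along N at fixed ρ for the smallest k) closes
the route `refuted:GaussianDomination` and retires the two-sector member of the GD family (engines
must then aim at the k⁻⁴ slack: restate
with L⁴/‖n‖⁴ as a NEW item, never a rewording). ¬PeriodicInfraredBound likewise (it is GD +
KLSTransfer). ¬BoundaryTransferWeak kills this
route and every route sharing stmt-0827, not the conjunct — pivot: re-run ModeCounting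
Dirichlet-natively through BECInfraredBound's
inner-box items (BecIrBoundInner, stmt-0733/0735). HardCoreExtension cannot be refuted without
refuting the conjunct; BECHardSphereReduction
proved moots it, the conjunct proved anywhere moots everything.

NOT DECOMPOSED YET. How to PROVE GaussianDomination (engines live on other cards/routes:
thomson-flow-gaussian-domination = route BECThomsonPrinciple,
sos-infrared-certificates = BECGroundStateSOS, log-concave-counts-brascamp-lieb,
kv-insertion-corrector, diamagnetic-gd-bootstrap); the
operator realisation of the variational GD and the symmetrisation lemma behind μ⁻ ≤ ρ‖v‖₁ (children
of KLSTransfer); N-body Parseval from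
the one-body cell Parseval and the lattice-point sums (children of ModeCounting); any dressing of
a(φ_k) for hard cores; positive
temperature; Dirichlet-box GD (translation invariance is used essentially: first order vanishes by
momentum).

CHEAPEST FALSIFIER. (a) One loop, already run by card triage-15/audit-29: the SHARP constant 1/k²
fails iff v̂ takes a negative value (energy density shifts by
2ρη²v̂(k₀) at μ = ρv̂(0)); the NON-SHARP windowed form filed here survives with C = 2 at small ρ —
consistent. (b) Next cheapest (one page
from Griffin1993 §6.3): the second-order (Beliaev) correction to b₊+b₋ at k → 2π/L — does k²(b₊+b₋)
stay bounded uniformly in L at fixed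
small ρ, or pick up log(Lk) from the Gavoret–Nozières / Nepomnyashchii structure (barrier
BogoliubovPerturbationInfrared)? A divergence
would not refute GD (perturbation theory is no proof) but would move the bet to the k⁻⁴-slack
restatement. (c) Free gas v ≡ 0 (checked by hand): b₊ = 1/k², b₋ = 0; the 2×2 blocks
{n_k = m} ⊕ {n_k = m+1} have lowest eigenvalue mk² + (k² − √(k⁴+4(m+1)t²))/2, so GD holds with C =
1/(4π²) (sup-norm window) exactly for
|t| ≤ t₀ ~ k² and FAILS for t ≫ k² — the t₀(N,L,n) in the statement is essential, not cosmetic.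
Lieb–Liniger is NOT a falsifier (d = 1
differs) but calibrates: there GD holds and the mode count fails, as it should.

NUMBERS. Bogoliubov: b₊ = u_k²/ε_k, b₋ = v_k²/ε_k, b₊+b₋ = (k²+gρ)/ε_k², g = 8πa, ε_k = √(k⁴+2gρk²);
2n_k+1 = (k²+gρ)/ε_k (KLS saturated);
d₋+d₊ ≤ k² + 2ρ‖v‖₁(1+n_k) gives the ρL²/‖n‖² term of the IR shape; counting with k_c = ρ^(5/12):
depletion/N ≲ ρ^(1/4) + ρ^(1/3) +
ρ^(5/12) + ½‖v‖₁ρ^(1/6) → 0. Bogoliubov's (unproved) thermodynamic depletion 1 − n₀/N =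
(8/3√π)√(ρa³). Items at open: 7 (3 cruxes, 3 support,
1 assembly); closes uses 5 of them.

DEFINITION REQUESTS. None: the one-particle transfer matrix element is written inline as a Bochner
integral with Matrix.vecCons (pattern of `occupation`), plane
waves as `cellWave` (PeriodicBoseGasFourier.lean). A named two-sector susceptibility /
`transferCoupling` would shorten the signatures —
suggested to the librarian, not required.

Novelty: Searches (2026-08-15, this seat): `lit search --hybrid "Gaussian domination Bose Einstein
condensation continuum interacting Bose gas
infrared bound"` (12 docs, textbooks only: Griffin1993, LSSY2005 pp. 36/56/142/167, Pethick–Smith,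
Zhai); `lit galaxy search "Gaussian
domination" --star all` (20 rows: Lieb Selecta panama:281672545206274, LSSY2005
panama:226765683294234, Fröhlich school, Friedli–Velenik,
Tasaki thesis, Björnberg — classical/lattice RP only); `lit search --source crossref "Gaussian
domination Bose condensation interacting
boson gas Sankovich Corgini"` (10: doi:10.1142/s0217979299002988, doi:10.1007/978-3-0348-8018-3_5,
doi:10.1016/j.physleta.2013.08.045,
doi:10.1023/b:tamp.0000029708.30746.56, doi:10.1142/9789812702364_0010 Corgini–Torres 2004 "IR
bounds and BEC: diagonalizable
perturbations"); `lit frontier AtomisticToContinuum --since 2022` (30 rows; BEC descendants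
arXiv:2510.20493, arXiv:2603.20776,
arXiv:2602.16566, arXiv:2605.06844 — energy/localisation methods, no IR bounds); openalex 429 and
searchd rc 75 once this hour; plus the
five refuter audits recorded on the card (2/13/14/29/37) and gen-1's searches (bridges: only
arXiv:2002.02678 cites KLS1988PRL).
Nearest prior art found: KLS1988JSP eq. (18) / DLS1978 / FrohlichSimonSpencer1976 (GD via RP; in
tree kls_xy_gaussianDomination_ground_holds);
CorginiSankovich1999 doi:10.1142/s0217979299002988, Corgini2003, BernalCorginiSankovich2004,
Sankovich2013, Corgini–Torres 2004 (postulated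
GD-type bounds on B  [refs: 10.1142/s0217979299002988, 10.1007/978-3-0348-8018-3_5, 10.1016/j.physleta.2013.08.045, 10.1023/b:tamp.0000029708.30746.56, 10.1142/9789812702364_0010, 2510.20493, 2603.20776, 2602.16566, 2605.06844, 2002.02678, doi:10.1142/s0217979299002988, doi:10.1007/978-3-0348-8018-3_5, doi:10.1016/j.physleta.2013.08.045, doi:10.1023/b, doi:10.1142/9789812702364_0010, Griffin1993, LSSY2005, DLS1978, FrohlichS]

Barriers (technique_class: Gaussian-domination infrared-bound KLS-transfer variational): - technique_class: Gaussian-domination infrared-bound KLS-transfer variational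
- Literature.Barriers.AtomisticToContinuum.HalfFillingReflectionPositivity: attacked head-on through
the door its own audit names ("a substitute … from Gaussian domination without reflection positivity
of the state"): RP is used in print ONLY to get GD; here GD is the crux itself, stated variationally
on the continuum torus — no lattice, no half filling, no particle–hole symmetry; everything
downstream is symmetry-free (DLS1978 §1) and proved in tree on the lattice. Honest: no proof
technique for GD without RP is in hand on this route (engines are other cards); the bet is Born >
scattering length plus the constant/window slack of the dilute regime.
- Literature.Barriers.AtomisticToContinuum.HalfFillingReflectionPositivityNarrow: consistent — its
rigidity concerns site-local antiunitary reflections of a lattice STATE; no reflection of any kind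
is posited.
- Literature.Barriers.AtomisticToContinuum.KineticGapLengthScales: evaded — no spectral gap at scale
L is ever multiplied by L²; the IR bound is gap-free and the UV tail uses only kinetic Chebyshev
with the Hartree budget; L-uniformity is carried entirely by the conjectured constant C of GD.
- Literature.Barriers.AtomisticToContinuum.EnergyAsymptoticsWithoutCondensation: evaded by design —
GD is an energy inequality for a FAMILY of perturbed two-sector Hamiltonians (a response/curvature
statement, the entry's own listed evasion), not asymptotics of

History (route lifecycle, newest last):
- 2026-08-25T02:40:42Z · DORMANT — reconciler: no traction for 7.3 d (last activity item-evidence-added at 2026-08-17T18:55:01Z); parked, not closed — `ledger route dormant route-AtomisticToConti (operator:999:3667583)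

sub-problem: BoseEinsteinCondensation · status: dormant · opened planner-plancard-AtomisticToContinuum-BoseEin-5cc91b26-g2-0 2026-08-15T18:55:42Z · rev 2 · ledger route-AtomisticToContinuum-BECTwoSectorGD
GENERATED by the gate from the ledger (D-0016/17). Provers cite these decls: `theorem foo : Summit.AtomisticToContinuum.BoseEinsteinCondensation.Theses.BECTwoSectorGD.<Decl> := …` in Summits/AtomisticToContinuum/BoseEinsteinCondensation/Theorems/<Name>.lean.
-/

namespace Summit.AtomisticToContinuum.BoseEinsteinCondensation.Theses.BECTwoSectorGD

open scoped BigOperators Topology Manifold Classical MeasureTheory ProbabilityTheory Matrix InnerProductSpace ComplexConjugate ContinuousMap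
open Filter Set Function TopologicalSpace MeasureTheory

attribute [summit_statement] _root_.BoseEinsteinCondensation

/-- item stmt-AtomisticToContinuum-12620 · crux · rank 2 · open · by planner
why it might fail: No RP in the continuum: beyond one loop nothing known keeps sup_N k²b_k bounded at fixed small ρ (Gavoret–Nozières logs could enter b at k ~ 2π/L); Speer1985: GD can fail without RP; L-uniformity down to zero density at fixed N ≥ N₀ is also asserted.
sources: KLS1988JSP, DLS1978, Speer1985, CorginiSankovich1999, LSSY2005, GavoretNozieres1964
[crux] TWO-SECTOR GAUSSIAN DOMINATION (non-sharp, windowed, integrable v; card item GD_can restated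
per audits 14/29/37): ∀ v repulsive finite-range with ∫v(|x|)dx < ∞ ∃ K ρ₀ C > 0 ∀ᶠ N ∀ L > 0 with
(N+1) ≤ ρ₀L³ ∀ n ∈ ℤ³∖0 with |2πn/L| ≤ K ∃ t₀ > 0 ∀ |t| ≤ t₀ ∀ p ∈ [0,1] ∀ finite-energy periodic
trial states Ψ (N particles), Φ (N+1 particles): p(E(Ψ) − E₀(N)) + (1−p)(E(Φ) − E₀(N+1)) +
2t√(p(1−p))·√(N+1)·Re∫conj(Ψ(Y))∫conj(φ_n(x))Φ(x,Y)dx dY ≥ −C t² L²/‖n‖², φ_n = L^(-3/2)·cellWave L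
n — the variational form of inf spec[(H_N−E₀(N)) ⊕ (H_(N+1)−E₀(N+1)) + t(a(φ_n)+a(φ_n)†)] ≥
−Ct²L²/‖n‖², i.e. b₊(N,k), b₋(N+1,k) ≤ C′/k². [difficulty: open-problem] -/
@[route_item "route-AtomisticToContinuum-BECTwoSectorGD", crux]
def GaussianDomination : Prop :=
  ∀ v : ℝ → ENNReal, Literature.MathematicalPhysics.QuantumManyBody.BoseGas.IsRepulsiveFiniteRange v → (∫⁻ x : EuclideanSpace ℝ (Fin 3), v ‖x‖) ≠ ⊤ → ∃ K : ℝ, 0 < K ∧ ∃ ρ₀ : ℝ, 0 < ρ₀ ∧ ∃ C : ℝ, 0 < C ∧ ∀ᶠ N : ℕ in Filter.atTop, ∀ L : ℝ, 0 < L → ((N : ℝ) + 1) ≤ ρ₀ * L ^ 3 → ∀ n : Fin 3 → ℤ, n ≠ 0 → 2 * Real.pi / L * ‖(fun j => (n j : ℝ))‖ ≤ K → ∃ t₀ : ℝ, 0 < t₀ ∧ ∀ t : ℝ, |t| ≤ t₀ → ∀ p : ℝ, 0 ≤ p → p ≤ 1 → ∀ Ψ : Literature.MathematicalPhysics.QuantumManyBody.BoseGas.PeriodicTrialState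 N L, ∀ Φ : Literature.MathematicalPhysics.QuantumManyBody.BoseGas.PeriodicTrialState (N + 1) L, Literature.MathematicalPhysics.QuantumManyBody.BoseGas.periodicEnergy v Ψ ≠ ⊤ → Literature.MathematicalPhysics.QuantumManyBody.BoseGas.periodicEnergy v Φ ≠ ⊤ → p * (Literature.MathematicalPhysics.QuantumManyBody.BoseGas.periodicGroundStateEnergy v N L).toReal + (1 - p) * (Literature.MathematicalPhysics.QuantumManyBody.BoseGas.periodicGroundStateEnergy v (N + 1) L).toReal - C * t ^ 2 * L ^ 2 / ‖(fun j => (n j : ℝ))‖ ^ 2 ≤ p * (Literature.MathematicalPhysics.QuantumManyBody.BoseGas.periodicEnergy v Ψ).toReal + (1 - p) * (Literature.MathematicalPhysics.QuantumManyBody.BoseGas.periodicEnergy v Φ).toReal + 2 * t * Real.sqrt (p * (1 - p)) * Real.sqrt ((N : ℝ) + 1) * (∫ Y in Literature.MathematicalPhysics.QuantumManyBody.BoseGas.cellN N L, (starRingEnd ℂ) (Ψ.ψ Y) * ∫ x in Literature.MathematicalPhysics.QuantumManyBody.BoseGas.cell L, (starRingEnd ℂ) (((Real.sqrt (L ^ 3))⁻¹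 : ℂ) * Literature.MathematicalPhysics.QuantumManyBody.BoseGas.cellWave L n x) * Φ.ψ (Matrix.vecCons x Y)).re

/-- item stmt-AtomisticToContinuum-0827 · crux · rank 3 · open · by planner
why it might fail: PeriodicBEC(v) is ground-state-only (δ after N): the Dirichlet GS is not a periodic near-minimiser (wall term ≫ δ above E₀^per), so no energy comparison; needs a structural Neumann-bracketing + mode-free criterion (λ_max ≥ tr γ²/N) not in print.
sources: LSSY2005, Robinson1976, arXiv:2603.20776, Fournais2020
[crux] BoundaryTransferWeak (mode-free boundary-condition transfer, per potential): for each
repulsive finite-range v, PeriodicBEC(v) implies ∃ρ₀>0 ∀ρ∈(0,ρ₀) HasGroundStateBEC v ρ (Dirichlet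
ground state, λ_max(γ) ≥ cN via condensateNumber). Not glue: near-minimiser slacks are O(N/L²) while
Dirichlet/periodic energies differ by a boundary term ≫ N/L², so no energy-comparison proof;
expected route: Neumann bracketing of interior sub-boxes (−Δ_Dir ≥ ⊕−Δ_Neu, v ≥ 0) + a mode-free
criterion (λ_max ≥ tr γ²/N). Only the ENERGY analogue is in print (LiebSeiringerSolovejYngvason2005
Ch. 2 after (2.8)). v ≡ 0: hypothesis and conclusion both true. -/
@[route_item "route-AtomisticToContinuum-BECTwoSectorGD", crux]
def BoundaryTransferWeak : Prop :=
  ∀ v : ℝ → ENNReal, Literature.MathematicalPhysics.QuantumManyBody.BoseGas.IsRepulsiveFiniteRange v → (∃ ρ₀ : ℝ, 0 < ρ₀ ∧ ∀ ρ : ℝ, 0 < ρ → ρ < ρ₀ → ∃ c : ℝ, 0 < c ∧ ∀ᶠ N : ℕ in Filter.atTop, ∃ δ : ENNReal, 0 < δ ∧ ∀ Ψ : Literature.MathematicalPhysics.QuantumManyBody.BoseGas.PeriodicTrialState N (Literature.MathematicalPhysics.QuantumManyBody.BoseGas.sideLength ρ N), Literature.MathematicalPhysics.QuantumManyBody.BoseGas.periodicEnergy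 v Ψ ≤ Literature.MathematicalPhysics.QuantumManyBody.BoseGas.periodicGroundStateEnergy v N (Literature.MathematicalPhysics.QuantumManyBody.BoseGas.sideLength ρ N) + δ → ENNReal.ofReal (c * N) ≤ Literature.MathematicalPhysics.QuantumManyBody.BoseGas.condensateOccupation N (Literature.MathematicalPhysics.QuantumManyBody.BoseGas.sideLength ρ N) Ψ.ψ) → ∃ ρ₀ : ℝ, 0 < ρ₀ ∧ ∀ ρ : ℝ, 0 < ρ → ρ < ρ₀ → Literature.MathematicalPhysics.QuantumManyBody.BoseGas.HasGroundStateBEC v ρ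

/-- item stmt-AtomisticToContinuum-12621 · crux · rank 4 · open · by planner
why it might fail: It is the conjunct on the non-integrable class given the integrable one: no truncation/comparison principle transfers condensate bounds from min(v,M) to v uniformly in M, condensate fractions are not monotone in v, and this line's constants blow up with ‖v‖₁.
sources: FournaisSolovej2022, LSSY2005, Fournais2020
[crux] SCOPE ITEM (the part of the class this line does not reach): dilute ground-state BEC for
every repulsive finite-range INTEGRABLE radial v (∫v(|x|)dx < ∞) implies the conjunct (all repulsive
finite-range radial v, incl. hard cores v = ⊤·1_[0,a] and non-integrable singularities). The
undressed transfer operator a(φ_k)† adds a plane-wave particle whose Hartree energy ρ∫v is the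
double commutator's constant, so hard cores are out of reach of THIS engine; expected discharges:
route BECHardSphereReduction (HardCoreDominates + HardSphereBEC prove the whole conjunct and moot
this item), a-only technology (FournaisSolovej2022, LSSY2005 Lemma 2.5 Dyson softening) or a
Jastrow-dressed a(fφ_k); uniform-in-M truncation min(v,M)↑v is NOT available here (constants carry
‖v‖₁). [difficulty: open-problem] -/
@[route_item "route-AtomisticToContinuum-BECTwoSectorGD", crux]
def HardCoreExtension : Prop :=
  (∀ v : ℝ → ENNReal, Literature.MathematicalPhysics.QuantumManyBody.BoseGas.IsRepulsiveFiniteRange v → (∫⁻ x : EuclideanSpace ℝ (Fin 3), v ‖x‖) ≠ ⊤ → ∃ ρ₀ : ℝ, 0 < ρ₀ ∧ ∀ ρ : ℝ, 0 < ρ → ρ < ρ₀ → Literature.MathematicalPhysics.QuantumManyBody.BoseGas.HasGroundStateBEC v ρ) → _root_.BoseEinsteinCondensation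

/-- item stmt-AtomisticToContinuum-12622 · support · rank 9 · closed · proved by Summit.AtomisticToContinuum.BoseEinsteinCondensation.Theorems.KLSTransfer_proof @ 59d590334532 (prover) · by planner
sources: KLS1988JSP, DLS1978, Kato1966, ReedSimonIV1978
[support] KENNEDY–LIEB–SHASTRY T=0 TRANSFER in the continuum: for integrable v, the
GaussianDomination body implies the periodic infrared-bound body — ∃K,ρ₀,C ∀ρ<ρ₀ ∀ᶠN ∃δ>0: every
δ-near-minimiser Ψ of the periodic N-body energy at L=(N/ρ)^(1/3) has n_Ψ(2πn/L) ≤ C(1 + √ρ·L/‖n‖ +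
ρL²/‖n‖²) for 0<|2πn/L|≤K. On paper (KLS1988JSP (12)–(14); DLS1978 §1): (i) variational GD ⇒
form-bounded block operator ⇒ (Kato, 2×2 degenerate second order, first order = 0 by momentum)
b₊(N), b₋(N) ≤ CL²/‖n‖² from the pairs (N,N+1), (N−1,N) at the same L; (ii) for the exact ground
state Ω: 2n_k+1 = ‖a_kΩ‖²+‖a_k†Ω‖² ≤ √((b₋+b₊)(d₋+d₊)) (Cauchy–Schwarz in the spectral measures of
H_(N∓1)−E₀(N∓1) ≥ 0), d₋+d₊ = ⟨[a_k,[H,a_k†]]⟩_Ω + μ⁻n_k − μ⁺(n_k+1) ≤ k² + 2ρ‖v‖₁ + ρ‖v‖₁n_k (|v̂|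
≤ ‖v‖₁; E₀(N+1) ≥ E₀(N); μ⁻ ≤ ρ‖v‖₁ by the product trial state), solve the quadratic inequality;
(iii) pass to δ-near-minimisers by compactness + uniqueness of Ω at fixed N, L (δ after N; finitely
many n; constant 2C). [difficulty: XL] -/
@[route_item "route-AtomisticToContinuum-BECTwoSectorGD", crux]
def KLSTransfer : Prop :=
  ∀ v : ℝ → ENNReal, Literature.MathematicalPhysics.QuantumManyBody.BoseGas.IsRepulsiveFiniteRange v → (∫⁻ x : EuclideanSpace ℝ (Fin 3), v ‖x‖) ≠ ⊤ → (∃ K : ℝ, 0 < K ∧ ∃ ρ₀ : ℝ, 0 < ρ₀ ∧ ∃ C : ℝ, 0 < C ∧ ∀ᶠ N : ℕ in Filter.atTop, ∀ L : ℝ, 0 < L → ((N : ℝ) + 1) ≤ ρ₀ * L ^ 3 → ∀ n : Fin 3 → ℤ, n ≠ 0 → 2 * Real.pi / L * ‖(fun j => (n j : ℝ))‖ ≤ K → ∃ t₀ : ℝ, 0 < t₀ ∧ ∀ t : ℝ, |t| ≤ t₀ → ∀ p : ℝ, 0 ≤ p → p ≤ 1 → ∀ Ψ : Literature.MathematicalPhysics.QuantumManyBody.BoseGas.PeriodicTrialState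 N L, ∀ Φ : Literature.MathematicalPhysics.QuantumManyBody.BoseGas.PeriodicTrialState (N + 1) L, Literature.MathematicalPhysics.QuantumManyBody.BoseGas.periodicEnergy v Ψ ≠ ⊤ → Literature.MathematicalPhysics.QuantumManyBody.BoseGas.periodicEnergy v Φ ≠ ⊤ → p * (Literature.MathematicalPhysics.QuantumManyBody.BoseGas.periodicGroundStateEnergy v N L).toReal + (1 - p) * (Literature.MathematicalPhysics.QuantumManyBody.BoseGas.periodicGroundStateEnergy v (N + 1) L).toReal - C * t ^ 2 * L ^ 2 / ‖(fun j => (n j : ℝ))‖ ^ 2 ≤ p * (Literature.MathematicalPhysics.QuantumManyBody.BoseGas.periodicEnergy v Ψ).toReal + (1 - p) * (Literature.MathematicalPhysics.QuantumManyBody.BoseGas.periodicEnergy v Φ).toReal + 2 * t * Real.sqrt (p * (1 - p)) * Real.sqrt ((N : ℝ) + 1) * (∫ Y in Literature.MathematicalPhysics.QuantumManyBody.BoseGas.cellN N L, (starRingEnd ℂ) (Ψ.ψ Y) * ∫ x in Literature.MathematicalPhysics.QuantumManyBody.BoseGas.cell L, (starRingEnd ℂ) (((Real.sqrt (L ^ 3))⁻¹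 : ℂ) * Literature.MathematicalPhysics.QuantumManyBody.BoseGas.cellWave L n x) * Φ.ψ (Matrix.vecCons x Y)).re) → ∃ K : ℝ, 0 < K ∧ ∃ ρ₀ : ℝ, 0 < ρ₀ ∧ ∃ C : ℝ, 0 < C ∧ ∀ ρ : ℝ, 0 < ρ → ρ < ρ₀ → ∀ᶠ N : ℕ in Filter.atTop, ∃ δ : ENNReal, 0 < δ ∧ ∀ Ψ : Literature.MathematicalPhysics.QuantumManyBody.BoseGas.PeriodicTrialState N (Literature.MathematicalPhysics.QuantumManyBody.BoseGas.sideLength ρ N), Literature.MathematicalPhysics.QuantumManyBody.BoseGas.periodicEnergy v Ψ ≤ Literature.MathematicalPhysics.QuantumManyBody.BoseGas.periodicGroundStateEnergy v N (Literature.MathematicalPhysics.QuantumManyBody.BoseGas.sideLength ρ N) + δ → ∀ n : Fin 3 → ℤ, n ≠ 0 → 2 * Real.pi / Literature.MathematicalPhysics.QuantumManyBody.BoseGas.sideLength ρ N * ‖(fun j => (n j : ℝ))‖ ≤ K → Literature.MathematicalPhysics.QuantumManyBody.BoseGas.cellOccupation N (Literature.MathematicalPhysics.QuantumManyBody.BoseGas.sideLength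 ρ N) (fun x => ((Real.sqrt (Literature.MathematicalPhysics.QuantumManyBody.BoseGas.sideLength ρ N ^ 3))⁻¹ : ℂ) * Literature.MathematicalPhysics.QuantumManyBody.BoseGas.cellWave (Literature.MathematicalPhysics.QuantumManyBody.BoseGas.sideLength ρ N) n x) Ψ.ψ ≤ ENNReal.ofReal (C * (1 + Real.sqrt ρ * Literature.MathematicalPhysics.QuantumManyBody.BoseGas.sideLength ρ N / ‖(fun j => (n j : ℝ))‖ + ρ * Literature.MathematicalPhysics.QuantumManyBody.BoseGas.sideLength ρ N ^ 2 / ‖(fun j => (n j : ℝ))‖ ^ 2))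

/-- item stmt-AtomisticToContinuum-12623 · support · rank 9 · open · by planner
sources: KLS1988PRL, DLS1978, LSSY2005, Fournais2020
[support] MODE COUNTING WITH THE √(ρa³) MODE DEFICIT: for integrable v, the periodic infrared-bound
body implies the PeriodicBEC body (hypothesis of BoundaryTransferWeak) — constant-mode occupation ≥
cN. On paper: Parseval on [0,L)³ for x ↦ Ψ(x,Y) (tsum_sq_cellFourierCoeff) gives Σ_n n_Ψ(n) = N and
Σ_n |2πn/L|² n_Ψ(n) = T(Ψ) ≤ E₀^per + δ ≤ ½ρ‖v‖₁N + δ (constant trial state); window cutoff k_c =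
ρ^(5/12) ≤ K: Σ_(0<|k|≤k_c) C(1+√ρL/‖n‖+ρL²/‖n‖²) ≲ (ρ^(1/4)+ρ^(1/3)+ρ^(5/12))N and Σ_(|k|>k_c) n_k
≤ T/k_c² ≤ (½‖v‖₁ρ^(1/6))N + δρ^(-5/6) — all o(N); pick ρ₀ so n₀ ≥ N/2. [difficulty: L] -/
@[route_item "route-AtomisticToContinuum-BECTwoSectorGD", crux]
def ModeCounting : Prop :=
  ∀ v : ℝ → ENNReal, Literature.MathematicalPhysics.QuantumManyBody.BoseGas.IsRepulsiveFiniteRange v → (∫⁻ x : EuclideanSpace ℝ (Fin 3), v ‖x‖) ≠ ⊤ → (∃ K : ℝ, 0 < K ∧ ∃ ρ₀ : ℝ, 0 < ρ₀ ∧ ∃ C : ℝ, 0 < C ∧ ∀ ρ : ℝ, 0 < ρ → ρ < ρ₀ → ∀ᶠ N : ℕ in Filter.atTop, ∃ δ : ENNReal, 0 < δ ∧ ∀ Ψ : Literature.MathematicalPhysics.QuantumManyBody.BoseGas.PeriodicTrialState N (Literature.MathematicalPhysics.QuantumManyBody.BoseGas.sideLength ρ N), Literature.MathematicalPhysics.QuantumManyBody.BoseGas.periodicEnergy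 v Ψ ≤ Literature.MathematicalPhysics.QuantumManyBody.BoseGas.periodicGroundStateEnergy v N (Literature.MathematicalPhysics.QuantumManyBody.BoseGas.sideLength ρ N) + δ → ∀ n : Fin 3 → ℤ, n ≠ 0 → 2 * Real.pi / Literature.MathematicalPhysics.QuantumManyBody.BoseGas.sideLength ρ N * ‖(fun j => (n j : ℝ))‖ ≤ K → Literature.MathematicalPhysics.QuantumManyBody.BoseGas.cellOccupation N (Literature.MathematicalPhysics.QuantumManyBody.BoseGas.sideLength ρ N) (fun x => ((Real.sqrt (Literature.MathematicalPhysics.QuantumManyBody.BoseGas.sideLength ρ N ^ 3))⁻¹ : ℂ) * Literature.MathematicalPhysics.QuantumManyBody.BoseGas.cellWave (Literature.MathematicalPhysics.QuantumManyBody.BoseGas.sideLength ρ N) n x) Ψ.ψ ≤ ENNReal.ofReal (C * (1 + Real.sqrt ρ * Literature.MathematicalPhysics.QuantumManyBody.BoseGas.sideLength ρ N / ‖(fun j => (n j : ℝ))‖ + ρ * Literature.MathematicalPhysics.QuantumManyBody.BoseGas.sideLength ρ N ^ 2 / ‖(fun j => (n j : ℝ))‖ ^ 2))) → ∃ ρ₀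 : ℝ, 0 < ρ₀ ∧ ∀ ρ : ℝ, 0 < ρ → ρ < ρ₀ → ∃ c : ℝ, 0 < c ∧ ∀ᶠ N : ℕ in Filter.atTop, ∃ δ : ENNReal, 0 < δ ∧ ∀ Ψ : Literature.MathematicalPhysics.QuantumManyBody.BoseGas.PeriodicTrialState N (Literature.MathematicalPhysics.QuantumManyBody.BoseGas.sideLength ρ N), Literature.MathematicalPhysics.QuantumManyBody.BoseGas.periodicEnergy v Ψ ≤ Literature.MathematicalPhysics.QuantumManyBody.BoseGas.periodicGroundStateEnergy v N (Literature.MathematicalPhysics.QuantumManyBody.BoseGas.sideLength ρ N) + δ → ENNReal.ofReal (c * N) ≤ Literature.MathematicalPhysics.QuantumManyBody.BoseGas.condensateOccupation N (Literature.MathematicalPhysics.QuantumManyBody.BoseGas.sideLength ρ N) Ψ.ψ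

/-- item stmt-AtomisticToContinuum-12624 · support · rank 9 · open · by planner
sources: KLS1988PRL, PitaevskiiStringari1991, LSSY2005
[support] STAND-ALONE PERIODIC T=0 INFRARED BOUND (= GaussianDomination + KLSTransfer by one line of
logic, theorem ir_of_gd of the sketch; the torus twin of BECInfraredBound.BecIrBoundInner with the
cruder KLS shape): ∀ integrable repulsive finite-range v ∃K,ρ₀,C ∀ρ<ρ₀ ∀ᶠN ∃δ: every
δ-near-minimiser Ψ of the periodic energy (L=(N/ρ)^(1/3)) has n_Ψ(2πn/L) ≤ C(1 + √ρL/‖n‖ + ρL²/‖n‖²)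
for 0<|2πn/L|≤K. Filed so refuters can attack the IR bound itself (¬ it kills the line) and so
non-GD engines (sector-gap, SOS, Landau cards) can target it by signature. Bogoliubov truth: n_k ≈
√(πρa)/|k| ∧ (ρa)²/|k|⁴. [difficulty: open-problem] -/
@[route_item "route-AtomisticToContinuum-BECTwoSectorGD"]
def PeriodicInfraredBound : Prop :=
  ∀ v : ℝ → ENNReal, Literature.MathematicalPhysics.QuantumManyBody.BoseGas.IsRepulsiveFiniteRange v → (∫⁻ x : EuclideanSpace ℝ (Fin 3), v ‖x‖) ≠ ⊤ → ∃ K : ℝ, 0 < K ∧ ∃ ρ₀ : ℝ, 0 < ρ₀ ∧ ∃ C : ℝ, 0 < C ∧ ∀ ρ : ℝ, 0 < ρ → ρ < ρ₀ → ∀ᶠ N : ℕ in Filter.atTop, ∃ δ : ENNReal, 0 < δ ∧ ∀ Ψ : Literature.MathematicalPhysics.QuantumManyBody.BoseGas.PeriodicTrialState N (Literature.MathematicalPhysics.QuantumManyBody.BoseGas.sideLength ρ N), Literature.MathematicalPhysics.QuantumManyBody.BoseGas.periodicEnergy v Ψ ≤ Literature.MathematicalPhysics.QuantumManyBody.BoseGas.periodicGroundStateEnergy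 v N (Literature.MathematicalPhysics.QuantumManyBody.BoseGas.sideLength ρ N) + δ → ∀ n : Fin 3 → ℤ, n ≠ 0 → 2 * Real.pi / Literature.MathematicalPhysics.QuantumManyBody.BoseGas.sideLength ρ N * ‖(fun j => (n j : ℝ))‖ ≤ K → Literature.MathematicalPhysics.QuantumManyBody.BoseGas.cellOccupation N (Literature.MathematicalPhysics.QuantumManyBody.BoseGas.sideLength ρ N) (fun x => ((Real.sqrt (Literature.MathematicalPhysics.QuantumManyBody.BoseGas.sideLength ρ N ^ 3))⁻¹ : ℂ) * Literature.MathematicalPhysics.QuantumManyBody.BoseGas.cellWave (Literature.MathematicalPhysics.QuantumManyBody.BoseGas.sideLength ρ N) n x) Ψ.ψ ≤ ENNReal.ofReal (C * (1 + Real.sqrt ρ * Literature.MathematicalPhysics.QuantumManyBody.BoseGas.sideLength ρ N / ‖(fun j => (n j : ℝ))‖ + ρ * Literature.MathematicalPhysics.QuantumManyBody.BoseGas.sideLength ρ N ^ 2 / ‖(fun j => (n j : ℝ))‖ ^ 2))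

/-- item stmt-AtomisticToContinuum-12625 · assembly · rank 1 · open · by planner
sources: KLS1988JSP, LSSY2005
[assembly] GaussianDomination → KLSTransfer → ModeCounting → BoundaryTransferWeak →
HardCoreExtension → BoseEinsteinCondensation (the sub-problem Statement decl). -/
@[route_item "route-AtomisticToContinuum-BECTwoSectorGD"]
def Assembly : Prop :=
  GaussianDomination → KLSTransfer → ModeCounting → BoundaryTransferWeak → HardCoreExtension → _root_.BoseEinsteinCondensation

/-! D-0027 §2.1 — DECIDING THEOREM (planner-authored via `route open/edit --closes-file`; by planner-plancard-AtomisticToContinuum-BoseEin-5cc91b26-g2-0 2026-08-15T18:55:42Z):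
its hypotheses are this route's items and its conclusion the sub-problem Statement (glue_lint), and it elaborates with this file. -/

@[closes "route-AtomisticToContinuum-BECTwoSectorGD"] theorem closes (h_GaussianDomination : GaussianDomination) (h_KLSTransfer : KLSTransfer) (h_ModeCounting : ModeCounting) (h_BoundaryTransferWeak : BoundaryTransferWeak) (h_HardCoreExtension : HardCoreExtension) : _root_.BoseEinsteinCondensation :=
  h_HardCoreExtension (fun v hv hi => h_BoundaryTransferWeak v hv (h_ModeCounting v hv hi (h_KLSTransfer v hv hi (h_GaussianDomination v hv hi))))

end Summit.AtomisticToContinuum.BoseEinsteinCondensation.Theses.BECTwoSectorGD
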